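import Literature.AlgebraicGeometry.Resolution.GeneralizedStabilityRankOneVTPairs
import Mathlib.GroupTheory.Sylow
import Mathlib.FieldTheory.Galois.Basic
import Mathlib.FieldTheory.PurelyInseparable.Basic
import HarnessLib

/-!
# Generalized stability for `K(x)^h`: the Galois case by induction on the degree (Kuhlmann 2010, §5)

Topic: `Literature/AlgebraicGeometry/Resolution` (valued function fields). Second of three files
assembling `Kuhlmann2010StabilityHenselizedRationalValueTranscendental`
(`GeneralizedStabilityRankOneVT.lean` = F.-V. Kuhlmann, *Elimination of ramification I*, Trans.
AMS 362 (2010) = arXiv:1003.5678, §5, proof of (R4), pp. 18–20: "the henselized rational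
function field `K(x)^h` of rank one with a value-transcendental generator over an algebraically
closed `K` is a defectless field") from the named facts of
`GeneralizedStabilityHenselizedRational.lean` and `Kuhlmann2010HenselizationIsHenselian`. The
printed argument (pp. 19–20) runs through the absolute ramification field:

> Since the ramification group is a `p`-group (cf. [En]), `F^sep|F^r` is a `p`-extension. It
> follows from the general theory of `p`-groups … via Galois correspondence that the maximal
> separable subextension of `E.F^r|F^r` is a finite tower of Galois extensions of degree `p`.
> … The proof that `E.N|N` is defectless now proceeds by induction on the number of extensions
> appearing in the tower. … there is a normal subextension `E'|N` of `E.N|N` of degree `p`. By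
> Corollary 4.2 or Proposition 3.1, this extension is defectless. From the preceding lemma we
> infer that `E'` is again a henselized inertially generated function field of rank 1 … By
> induction hypothesis, `(E|E',v)` is also defectless since it has a smaller degree than `E|N`.
> Hence by Lemma 2.13, `(E|N,v)` is defectless.

Here the same induction is run at the level of FINITE Galois theory, with Mathlib's Sylow
theory in place of the ramification field `F^r` and Prop. 2.18: for a finite Galois extension
`E|M` of a field `M = K(x')^h` of the class, either `p ∤ [E : M]` (Ostrowski's lemma), or a
`p`-Sylow subgroup `P ≠ G` of the Galois group cuts `E|M` into `E^P|M` of degree prime to `p`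
(Ostrowski) and the Galois extension `E|E^P` of smaller degree, or `G` is a `p`-group and a
central subgroup of order `p` cuts `E|M` into a Galois extension of degree `[E : M]/p` and a
step of degree `p` (defectless by the italicized statement of §5,
`isDefectlessPair_of_relFinrank_eq_ringExpChar`); every intermediate field is again of the
class by Lemma 5.5 (`exists_eq_henselizedAdjoin_of_relFinite`), and Lemma 2.13
(`isDefectlessPair_tower_iff`) reassembles.

## Content

* `relFinrank_eq_finrank`, `relRamificationIndex_eq`, … — the `rel*` invariants of
  `GeneralizedStabilityRankOneVTPairs.lean` computed in any compatible algebra structure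
  (`IsScalarTower M E Ω` forces the inclusion algebra, `algebra_eq_inclusion`). PROVED.
* `liftSubfield S` (an intermediate field of `E|M` as a subfield of `Ω`), `liftSubfieldEquiv`,
  `toSubfieldAlgEquiv` — DEFINITIONS, with the transport of degrees, finiteness, the Galois
  property, separability and pure inseparability (`relFinrank_liftSubfield_eq`,
  `isGalois_liftSubfield_top`, `isGalois_liftSubfield_bot`, `isSeparable_liftSubfield_bot`,
  `pow_mem_liftSubfield`, `relFinite_toSubfield`, `isGalois_toSubfield`, through Mathlib's
  `IsGalois.of_equiv_equiv` / `IsGalois.of_algEquiv`). PROVED.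
* `VTHypotheses K` — the bundle of inputs (the four named facts and `K` algebraically closed);
  `IsHenselizedRationalVT V K M` — "`M = K(x)^h` of rank one with `x` value-transcendental over
  `K`" (§2.5, (4.2)). DEFINITIONS, with `IsHenselizedRationalVT.of_relFinite` (Lemma 5.5),
  `.isDefectlessPair_of_relFinrank_eq` (steps of degree `p`), `.isDefectlessPair_of_not_dvd`
  (Ostrowski). PROVED.
* `isDefectlessPair_of_isGalois` — **finite Galois extensions of `K(x)^h`-fields are
  defectless**, by strong induction on the degree as described above. PROVED.

## Sources

* F.-V. Kuhlmann, *Elimination of ramification I: The generalized stability theorem*, Trans.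
  Amer. Math. Soc. 362 (2010) 5697–5727 = arXiv:1003.5678: §2.3 ((9), Lemma 2.13), §2.5,
  §5 (proof of (R4), pp. 18–20; Lemma 5.5).
* The finite group theory (Sylow subgroups, `p`-groups have non-trivial centre) is Mathlib's
  (`Sylow`, `IsPGroup.center_nontrivial`); it replaces [H] = B. Huppert, *Endliche Gruppen I*,
  III §7, cited by the source for the structure of `p`-groups.

## Rendering notes

* The source's reduction to `E.F^r|F^r` (infinite Galois theory, Prop. 2.18 of [K6]) is not
  needed at the finite level: Ostrowski's lemma ((9)) handles the steps of degree prime to `p`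
  directly, so the only named facts entering are (9), the italicized statement and Lemma 5.5.
-/

noncomputable section

open IsLocalRing

namespace Literature.AlgebraicGeometry.Resolution

universe u

/-! ### Compatible algebra structures on pairs of subfields -/

section Compat

variable {Ω : Type u} [Field Ω]
variable {M E : Subfield Ω} [Algebra M E] [IsScalarTower M E Ω]

/-- For a compatible `M`-algebra structure on `E` (`IsScalarTower M E Ω`), the structure map is
the inclusion. [folklore] -/
theorem coe_algebraMap_of_isScalarTower (c : M) : ((algebraMap M E c : E) : Ω) = c :=
  (IsScalarTower.algebraMap_apply M E Ω c).symm

/-- A compatible `M`-algebra structure on `E` forces `M ≤ E`. [folklore] -/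
theorem le_of_isScalarTower : M ≤ E := fun c hc => by
  have h := (algebraMap M E ⟨c, hc⟩).2
  rwa [coe_algebraMap_of_isScalarTower (M := M) (E := E) ⟨c, hc⟩] at h

/-- A compatible `M`-algebra structure on `E` IS the inclusion algebra. [folklore] -/
theorem algebra_eq_inclusion (h : M ≤ E) :
    (inferInstance : Algebra M E) = (Subfield.inclusion h).toAlgebra :=
  Algebra.algebra_ext _ _ fun c => Subtype.ext (coe_algebraMap_of_isScalarTower c)

/-- `[E : M]` for a compatible algebra structure is `relFinrank`. [folklore] -/
theorem relFinrank_eq_finrank (h : M ≤ E) : relFinrank M E h = Module.finrank M E := by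
  have := algebra_eq_inclusion (M := M) (E := E) h
  unfold relFinrank
  exact (congrArg (fun i : Algebra M E => @Module.finrank M E _ _ i.toModule) this).symm

/-- `RelFinite` for a compatible algebra structure is `FiniteDimensional`. [folklore] -/
theorem relFinite_iff_finiteDimensional (h : M ≤ E) : RelFinite M E h ↔ FiniteDimensional M E := by
  have := algebra_eq_inclusion (M := M) (E := E) h
  unfold RelFinite
  rw [← this]

/-- `e(E|M)` for a compatible algebra structure is `relRamificationIndex`. [folklore] -/
theorem relRamificationIndex_eq (V : ValuationSubring Ω) (h : M ≤ E) :
    relRamificationIndex V M E h = ramificationIndex M (V.comap (algebraMap E Ω)) := by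
  have := algebra_eq_inclusion (M := M) (E := E) h
  unfold relRamificationIndex
  exact (congrArg (fun i : Algebra M E => @ramificationIndex M E _ _ i (V.comap (algebraMap E Ω)))
    this).symm

/-- `f(E|M)` for a compatible algebra structure is `relInertiaDegree`. [folklore] -/
theorem relInertiaDegree_eq (V : ValuationSubring Ω) (h : M ≤ E) :
    relInertiaDegree V M E h = inertiaDegree M (V.comap (algebraMap E Ω)) := by
  have := algebra_eq_inclusion (M := M) (E := E) h
  unfold relInertiaDegree
  exact (congrArg (fun i : Algebra M E => @inertiaDegree M E _ _ i (V.comap (algebraMap E Ω)))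
    this).symm

end Compat

/-! ### Intermediate fields of a pair of subfields, as subfields of `Ω` -/

section Lift

variable {Ω : Type u} [Field Ω]
variable {M E : Subfield Ω} [Algebra M E]

/-- An intermediate field `S` of `E|M` as a subfield of `Ω`. [folklore] -/
def liftSubfield (S : IntermediateField M E) : Subfield Ω :=
  S.toSubfield.map (algebraMap E Ω)

/-- Membership in the lifted intermediate field. [folklore] -/
theorem mem_liftSubfield_iff (S : IntermediateField M E) (y : Ω) :
    y ∈ liftSubfield S ↔ ∃ hy : y ∈ E, (⟨y, hy⟩ : E) ∈ S := by
  unfold liftSubfield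
  rw [Subfield.mem_map]
  constructor
  · rintro ⟨z, hz, rfl⟩
    exact ⟨z.2, hz⟩
  · rintro ⟨hy, hz⟩
    exact ⟨⟨y, hy⟩, hz, rfl⟩

/-- `liftSubfield S ≤ E`. [folklore] -/
theorem liftSubfield_le (S : IntermediateField M E) : liftSubfield S ≤ E := fun y hy =>
  ((mem_liftSubfield_iff S y).mp hy).1

/-- The identification `S ≃ liftSubfield S`. [folklore] -/
def liftSubfieldEquiv (S : IntermediateField M E) : S ≃+* liftSubfield S :=
  RingEquiv.ofBijective
    ((algebraMap E Ω).restrict S.toSubfield.toSubring (liftSubfield S).toSubring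
      fun z hz => Subfield.mem_map.mpr ⟨z, hz, rfl⟩)
    (by
      constructor
      · intro a b hab
        have h := congrArg Subtype.val hab
        exact Subtype.ext (Subtype.ext h)
      · rintro ⟨y, hy⟩
        obtain ⟨hyE, hyS⟩ := (mem_liftSubfield_iff S y).mp hy
        exact ⟨⟨⟨y, hyE⟩, hyS⟩, rfl⟩)

/-- The identification `S ≃ liftSubfield S` is the identity on `Ω`. [folklore] -/
@[simp]
theorem coe_liftSubfieldEquiv (S : IntermediateField M E) (z : S) :
    ((liftSubfieldEquiv S z : liftSubfield S) : Ω) = ((z : E) : Ω) := rfl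

/-- `[E : liftSubfield S] = [E : S]`. [folklore] -/
theorem relFinrank_liftSubfield_eq (S : IntermediateField M E) :
    relFinrank (liftSubfield S) E (liftSubfield_le S) = Module.finrank S E := by
  letI : Algebra (liftSubfield S) E := (Subfield.inclusion (liftSubfield_le S)).toAlgebra
  unfold relFinrank
  symm
  exact Algebra.finrank_eq_of_equiv_equiv (liftSubfieldEquiv S) (RingEquiv.refl E)
    (RingHom.ext fun z => Subtype.ext rfl)

/-- `E|liftSubfield S` is finite if `E|S` is. [folklore] -/
theorem relFinite_liftSubfield (S : IntermediateField M E) [FiniteDimensional S E] :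
    RelFinite (liftSubfield S) E (liftSubfield_le S) := by
  letI : Algebra (liftSubfield S) E := (Subfield.inclusion (liftSubfield_le S)).toAlgebra
  unfold RelFinite
  exact Module.Finite.of_equiv_equiv (liftSubfieldEquiv S) (RingEquiv.refl E)
    (RingHom.ext fun z => Subtype.ext rfl)

/-- `E|liftSubfield S` is Galois if `E|S` is. [folklore] -/
theorem isGalois_liftSubfield_top (S : IntermediateField M E) [IsGalois S E] :
    letI : Algebra (liftSubfield S) E := (Subfield.inclusion (liftSubfield_le S)).toAlgebra
    IsGalois (liftSubfield S) E := by
  letI : Algebra (liftSubfield S) E := (Subfield.inclusion (liftSubfield_le S)).toAlgebra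
  exact IsGalois.of_equiv_equiv (f := liftSubfieldEquiv S) (g := RingEquiv.refl E)
    (RingHom.ext fun z => Subtype.ext rfl)

/-- `E|liftSubfield S` is purely inseparable (elementwise `q^k`-th powers) if `E|S` is. [folklore] -/
theorem pow_mem_liftSubfield (S : IntermediateField M E) [IsPurelyInseparable S E] (q : ℕ)
    [ExpChar S q] (y : Ω) (hy : y ∈ E) : ∃ k : ℕ, y ^ q ^ k ∈ liftSubfield S := by
  obtain ⟨k, z, hz⟩ := IsPurelyInseparable.pow_mem S q (⟨y, hy⟩ : E)
  refine ⟨k, (mem_liftSubfield_iff S _).mpr ⟨E.pow_mem hy _, ?_⟩⟩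
  have : (⟨y, hy⟩ : E) ^ q ^ k = ⟨y ^ q ^ k, E.pow_mem hy _⟩ := Subtype.ext rfl
  rw [← this, ← hz]
  exact z.2

variable [IsScalarTower M E Ω]

/-- `M ≤ liftSubfield S`. [folklore] -/
theorem le_liftSubfield (S : IntermediateField M E) : M ≤ liftSubfield S := fun c hc =>
  (mem_liftSubfield_iff S c).mpr ⟨le_of_isScalarTower (M := M) (E := E) hc, by
    have : (⟨c, le_of_isScalarTower (M := M) (E := E) hc⟩ : E) = algebraMap M E ⟨c, hc⟩ :=
      Subtype.ext (coe_algebraMap_of_isScalarTower (M := M) (E := E) ⟨c, hc⟩).symm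
    rw [this]
    exact S.algebraMap_mem _⟩

omit [IsScalarTower M E Ω] in
/-- The structure map `M → S → liftSubfield S` on `Ω`. [folklore] -/
theorem coe_liftSubfieldEquiv_algebraMap (S : IntermediateField M E) (c : M) :
    ((liftSubfieldEquiv S (algebraMap M S c) : liftSubfield S) : Ω) = ((algebraMap M E c : E) : Ω) :=
  rfl

/-- `[liftSubfield S : M] = [S : M]`. [folklore] -/
theorem relFinrank_eq_liftSubfield (S : IntermediateField M E) :
    relFinrank M (liftSubfield S) (le_liftSubfield S) = Module.finrank M S := by
  letI : Algebra M (liftSubfield S) := (Subfield.inclusion (le_liftSubfield S)).toAlgebra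
  unfold relFinrank
  symm
  refine Algebra.finrank_eq_of_equiv_equiv (RingEquiv.refl M) (liftSubfieldEquiv S)
    (RingHom.ext fun c => Subtype.ext ?_)
  change (c : Ω) = ((liftSubfieldEquiv S (algebraMap M S c) : liftSubfield S) : Ω)
  rw [coe_liftSubfieldEquiv_algebraMap, coe_algebraMap_of_isScalarTower]

/-- `liftSubfield S|M` is finite if `S|M` is. [folklore] -/
theorem relFinite_liftSubfield_bot (S : IntermediateField M E) [FiniteDimensional M S] :
    RelFinite M (liftSubfield S) (le_liftSubfield S) := by
  letI : Algebra M (liftSubfield S) := (Subfield.inclusion (le_liftSubfield S)).toAlgebra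
  unfold RelFinite
  refine Module.Finite.of_equiv_equiv (RingEquiv.refl M) (liftSubfieldEquiv S)
    (RingHom.ext fun c => Subtype.ext ?_)
  change (c : Ω) = ((liftSubfieldEquiv S (algebraMap M S c) : liftSubfield S) : Ω)
  rw [coe_liftSubfieldEquiv_algebraMap, coe_algebraMap_of_isScalarTower]

/-- `liftSubfield S|M` is Galois if `S|M` is. [folklore] -/
theorem isGalois_liftSubfield_bot (S : IntermediateField M E) [IsGalois M S] :
    letI : Algebra M (liftSubfield S) := (Subfield.inclusion (le_liftSubfield S)).toAlgebra
    IsGalois M (liftSubfield S) := by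
  letI : Algebra M (liftSubfield S) := (Subfield.inclusion (le_liftSubfield S)).toAlgebra
  refine IsGalois.of_equiv_equiv (f := RingEquiv.refl M) (g := liftSubfieldEquiv S)
    (RingHom.ext fun c => Subtype.ext ?_)
  change (c : Ω) = ((liftSubfieldEquiv S (algebraMap M S c) : liftSubfield S) : Ω)
  rw [coe_liftSubfieldEquiv_algebraMap, coe_algebraMap_of_isScalarTower]

/-- `liftSubfield S|M` is separable if `S|M` is. [folklore] -/
theorem isSeparable_liftSubfield_bot (S : IntermediateField M E) [Algebra.IsSeparable M S] :
    letI : Algebra M (liftSubfield S) := (Subfield.inclusion (le_liftSubfield S)).toAlgebra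
    Algebra.IsSeparable M (liftSubfield S) := by
  letI : Algebra M (liftSubfield S) := (Subfield.inclusion (le_liftSubfield S)).toAlgebra
  refine Algebra.IsSeparable.of_equiv_equiv (RingEquiv.refl M) (liftSubfieldEquiv S)
    (RingHom.ext fun c => Subtype.ext ?_)
  change (c : Ω) = ((liftSubfieldEquiv S (algebraMap M S c) : liftSubfield S) : Ω)
  rw [coe_liftSubfieldEquiv_algebraMap, coe_algebraMap_of_isScalarTower]

end Lift

/-! ### Intermediate fields of `Ω|M` as subfields of `Ω` -/

section ToSubfield

variable {Ω : Type u} [Field Ω] {M : Subfield Ω}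

/-- `M ≤ N₀` for an intermediate field `N₀` of `Ω|M`. [folklore] -/
theorem le_toSubfield_of_intermediateField (N₀ : IntermediateField M Ω) : M ≤ N₀.toSubfield :=
  fun c hc => N₀.algebraMap_mem ⟨c, hc⟩

/-- The identity `N₀ ≃ₐ[M] N₀.toSubfield` (the latter an `M`-algebra by inclusion). [folklore] -/
def toSubfieldAlgEquiv (N₀ : IntermediateField M Ω) :
    letI : Algebra M N₀.toSubfield :=
      (Subfield.inclusion (le_toSubfield_of_intermediateField N₀)).toAlgebra
    N₀ ≃ₐ[M] N₀.toSubfield :=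
  letI : Algebra M N₀.toSubfield :=
    (Subfield.inclusion (le_toSubfield_of_intermediateField N₀)).toAlgebra
  { toFun := fun z => ⟨z.1, z.2⟩
    invFun := fun z => ⟨z.1, z.2⟩
    left_inv := fun _ => rfl
    right_inv := fun _ => rfl
    map_mul' := fun _ _ => rfl
    map_add' := fun _ _ => rfl
    commutes' := fun _ => rfl }

/-- `N₀.toSubfield|M` is finite if `N₀|M` is. [folklore] -/
theorem relFinite_toSubfield (N₀ : IntermediateField M Ω) [h : FiniteDimensional M N₀] :
    RelFinite M N₀.toSubfield (le_toSubfield_of_intermediateField N₀) := by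
  letI : Algebra M N₀.toSubfield :=
    (Subfield.inclusion (le_toSubfield_of_intermediateField N₀)).toAlgebra
  haveI h' : @Module.Finite M N₀ _ _ Algebra.toModule := h
  unfold RelFinite
  exact Module.Finite.equiv (toSubfieldAlgEquiv N₀).toLinearEquiv

/-- `N₀.toSubfield|M` is Galois if `N₀|M` is. [folklore] -/
theorem isGalois_toSubfield (N₀ : IntermediateField M Ω) [h : IsGalois M N₀] :
    letI : Algebra M N₀.toSubfield :=
      (Subfield.inclusion (le_toSubfield_of_intermediateField N₀)).toAlgebra
    IsGalois M N₀.toSubfield := by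
  letI : Algebra M N₀.toSubfield :=
    (Subfield.inclusion (le_toSubfield_of_intermediateField N₀)).toAlgebra
  exact @IsGalois.of_algEquiv _ _ _ _ _ _ _ _ h (toSubfieldAlgEquiv N₀)

end ToSubfield

/-! ### The hypotheses and the class of base fields `K(x)^h` -/

section Induction

variable {Ω : Type u} [Field Ω] (V : ValuationSubring Ω) (K : Subfield Ω)

/-- **The inputs of the assembly**: the named facts "the henselization is henselian"
(`Kuhlmann2010HenselizationIsHenselian`, §1.1 / Lemma 2.3), the Lemma of Ostrowski
(`Kuhlmann2010OstrowskiLemma`, (9)), the italicized statement of §5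
(`Kuhlmann2010HenselizedRationalImmediateExt`) and Lemma 5.5
(`Kuhlmann2010Lemma55ValueTranscendental`), together with an algebraically closed ground field
`K ≤ Ω`. [cite: Kuhlmann2010, Section 5, proof of Thm. 1.1 (pp. 18–20)] -/
structure VTHypotheses : Prop where
  /-- `E^h` is henselian (§1.1, Lemma 2.3). -/
  hH : Kuhlmann2010HenselizationIsHenselian.{u}
  /-- The Lemma of Ostrowski, (9). -/
  hO : Kuhlmann2010OstrowskiLemma.{u}
  /-- The italicized statement of §5 (p. 19). -/
  hM : Kuhlmann2010HenselizedRationalImmediateExt.{u}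
  /-- Lemma 5.5 (Case I). -/
  h55 : Kuhlmann2010Lemma55ValueTranscendental.{u}
  /-- The ground field `K` is algebraically closed. -/
  hK : IsAlgClosed K

/-- **The base fields of the induction**: `M = K(x)^h` for some `x` value-transcendental over
`K`, with `(K(x)^h, v)` of rank one ("a henselized rational function field of rank 1 with a
value-transcendental generator", §2.5 / (4.2)). [cite: Kuhlmann2010, Section 2.5] -/
def IsHenselizedRationalVT (M : Subfield Ω) : Prop :=
  ∃ x : Ω, IsValueTranscendentalOver V K x ∧ IsRankOneValued V (henselizedAdjoin V K x) ∧
    M = henselizedAdjoin V K x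

variable {V K} [IsAlgClosed Ω]

/-- `K(x)^h`-fields are henselian. [cite: Kuhlmann2010, Lemma 2.3] -/
theorem IsHenselizedRationalVT.isHenselianField (hyp : VTHypotheses K) {M : Subfield Ω}
    (hM : IsHenselizedRationalVT V K M) : IsHenselianField M (V.comap (algebraMap M Ω)) := by
  obtain ⟨x, -, -, rfl⟩ := hM
  exact isHenselianField_henselizedAdjoin hyp.hH K x

omit [IsAlgClosed Ω] in
/-- `K(x)^h`-fields have rank one. [folklore] -/
theorem IsHenselizedRationalVT.isRankOneValued {M : Subfield Ω} (hM : IsHenselizedRationalVT V K M) :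
    IsRankOneValued V M := by
  obtain ⟨x, -, hr, rfl⟩ := hM
  exact hr

/-- **Finite extensions of `K(x)^h`-fields are `K(x')^h`-fields** (Lemma 5.5).
[cite: Kuhlmann2010, Lemma 5.5] -/
theorem IsHenselizedRationalVT.of_relFinite (hyp : VTHypotheses K) {M N : Subfield Ω}
    (hM : IsHenselizedRationalVT V K M) (h : M ≤ N) (hfin : RelFinite M N h) :
    IsHenselizedRationalVT V K N := by
  obtain ⟨x, hx, hr, rfl⟩ := hM
  obtain ⟨x', hx'N, hx', hN⟩ :=
    exists_eq_henselizedAdjoin_of_relFinite hyp.hH hyp.h55 hyp.hK hx hr h hfin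
  refine ⟨x', hx', ?_, hN⟩
  rw [← hN]
  exact hr.of_algebraic V h (forall_isAlgebraic_of_relFinite h hfin)

/-- **Steps of degree `p` over a `K(x)^h`-field are defectless.**
[cite: Kuhlmann2010, Section 5, proof of Thm. 1.1 (pp. 19–20)] -/
theorem IsHenselizedRationalVT.isDefectlessPair_of_relFinrank_eq (hyp : VTHypotheses K)
    {M N : Subfield Ω} (hM : IsHenselizedRationalVT V K M) (h : M ≤ N) (hfin : RelFinite M N h)
    (hp : 1 < ringExpChar (ResidueField V))
    (hdeg : relFinrank M N h = ringExpChar (ResidueField V)) : IsDefectlessPair V M N h := by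
  obtain ⟨x, hx, hr, rfl⟩ := hM
  exact isDefectlessPair_of_relFinrank_eq_ringExpChar hyp.hH hyp.hO hyp.hM hyp.hK hx hr h hfin
    hp hdeg

/-- **Steps of degree prime to `p` (or any degree if `p = 1`) over a `K(x)^h`-field are
defectless** (Ostrowski). [cite: Kuhlmann2010, Section 2.3, (9)] -/
theorem IsHenselizedRationalVT.isDefectlessPair_of_not_dvd (hyp : VTHypotheses K)
    {M N : Subfield Ω} (hM : IsHenselizedRationalVT V K M) (h : M ≤ N) (hfin : RelFinite M N h)
    (hnd : ringExpChar (ResidueField V) = 1 ∨ ¬ ringExpChar (ResidueField V) ∣ relFinrank M N h) :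
    IsDefectlessPair V M N h := by
  rcases hnd with h1 | hnd
  · exact isDefectlessPair_of_ringExpChar_eq_one hyp.hO h (hM.isHenselianField hyp) hfin h1
  · exact Literature.AlgebraicGeometry.Resolution.isDefectlessPair_of_not_dvd hyp.hO h
      (hM.isHenselianField hyp) hfin hnd

omit [IsAlgClosed Ω] in
/-- An extension of relative degree `1` is defectless (`e f ≤ 1 ≤ e f`). [folklore] -/
theorem isDefectlessPair_of_relFinrank_eq_one {M N : Subfield Ω} (h : M ≤ N) (hfin : RelFinite M N h)
    (h1 : relFinrank M N h = 1) : IsDefectlessPair V M N h := by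
  have hle := relRamificationIndex_mul_relInertiaDegree_le (V := V) h hfin
  obtain ⟨he, hf⟩ := one_le_relRamificationIndex_and_relInertiaDegree (V := V) h hfin
  unfold IsDefectlessPair
  rw [h1] at hle ⊢
  have : 1 ≤ relRamificationIndex V M N h * relInertiaDegree V M N h := Nat.one_le_iff_ne_zero.mpr
    (Nat.mul_ne_zero (by omega) (by omega))
  omega

/-! ### The Galois case: induction on the degree through Sylow and central subgroups -/

/-- **Finite Galois extensions of `K(x)^h`-fields are defectless** (the induction of p. 20,
run at the level of finite Galois theory): by strong induction on `n = [E : M]`. If `p ∤ n`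
(`p` the residue characteristic exponent) Ostrowski's lemma concludes. Otherwise let `P` be a
`p`-Sylow subgroup of `G = Gal(E|M)`. If `P ≠ G`, its fixed field `N` has degree `[G : P]`
prime to `p` over `M` (defectless by Ostrowski), is again a `K(x')^h`-field (Lemma 5.5), and
`E|N` is Galois of degree `|P| < n` (induction). If `P = G`, a central subgroup `C` of order
`p` is normal; its fixed field `N` is Galois of degree `n/p` over `M` (induction), again a
`K(x')^h`-field, and `E|N` has degree `p`, hence is defectless by the italicized statement of
§5. In both cases Lemma 2.13 (multiplicativity) concludes.
[cite: Kuhlmann2010, Section 5, proof of Thm. 1.1 (pp. 19–20)] -/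
theorem isDefectlessPair_of_isGalois (hyp : VTHypotheses K) (n : ℕ) :
    ∀ (M E : Subfield Ω) (h : M ≤ E), IsHenselizedRationalVT V K M → RelFinite M E h →
      (letI : Algebra M E := (Subfield.inclusion h).toAlgebra; IsGalois M E) →
      relFinrank M E h = n → IsDefectlessPair V M E h := by
  induction n using Nat.strong_induction_on with
  | _ n ih =>
  intro M E h hM hfin hgal hn
  letI : Algebra M E := (Subfield.inclusion h).toAlgebra
  haveI : IsScalarTower M E Ω := IsScalarTower.of_algebraMap_eq fun _ => rfl
  haveI : FiniteDimensional M E := hfin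
  haveI : IsGalois M E := hgal
  set p := ringExpChar (ResidueField V) with hpdef
  -- residue characteristic `0`, or degree prime to `p`: Ostrowski
  by_cases hp1 : p = 1
  · exact hM.isDefectlessPair_of_not_dvd hyp h hfin (Or.inl hp1)
  by_cases hdvd : ¬ p ∣ n
  · exact hM.isDefectlessPair_of_not_dvd hyp h hfin (Or.inr (hn ▸ hdvd))
  push Not at hdvd
  have hpprime : p.Prime := (expChar_is_prime_or_one (ResidueField V) p).resolve_right hp1
  haveI : Fact p.Prime := ⟨hpprime⟩
  have hp2 : 1 < p := hpprime.one_lt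
  -- the Galois group and its cardinality
  have hcard : Nat.card (E ≃ₐ[M] E) = n := by
    rw [IsGalois.card_aut_eq_finrank]; exact hn
  have hn1 : 1 ≤ n := hn ▸ one_le_relFinrank h hfin
  obtain ⟨P⟩ : Nonempty (Sylow p (E ≃ₐ[M] E)) := inferInstance
  by_cases hPtop : (P : Subgroup (E ≃ₐ[M] E)) = ⊤
  · -- `G` is a `p`-group: a central subgroup `C` of order `p`
    have hG : IsPGroup p (E ≃ₐ[M] E) := by
      intro g
      obtain ⟨k, hk⟩ := P.isPGroup' ⟨g, hPtop ▸ Subgroup.mem_top g⟩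
      exact ⟨k, by simpa using congrArg Subtype.val hk⟩
    have hn2 : 1 < n := by
      have := Nat.le_of_dvd (by omega) hdvd
      omega
    haveI : Nontrivial (E ≃ₐ[M] E) := Finite.one_lt_card_iff_nontrivial.mp (by omega)
    haveI := IsPGroup.center_nontrivial hG
    have hZ : p ∣ Nat.card (Subgroup.center (E ≃ₐ[M] E)) := by
      rcases (hG.to_subgroup (Subgroup.center _)).card_eq_or_dvd with h1 | h1
      · exact absurd h1 (Finite.one_lt_card_iff_nontrivial.mpr inferInstance).ne'
      · exact h1
    obtain ⟨z, hz⟩ := exists_prime_orderOf_dvd_card' p hZ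
    let g : E ≃ₐ[M] E := z
    have hg : orderOf g = p := by rw [Subgroup.orderOf_coe]; exact hz
    have hgZ : g ∈ Subgroup.center (E ≃ₐ[M] E) := z.2
    let C : Subgroup (E ≃ₐ[M] E) := Subgroup.zpowers g
    haveI hCn : C.Normal := by
      refine ⟨fun a ha b => ?_⟩
      have haZ : a ∈ Subgroup.center (E ≃ₐ[M] E) := (Subgroup.zpowers_le.mpr hgZ) ha
      have : b * a * b⁻¹ = a := by
        rw [Subgroup.mem_center_iff.mp haZ b, mul_inv_cancel_right]
      rw [this]; exact ha
    have hCcard : Nat.card C = p := by rw [Nat.card_zpowers]; exact hg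
    -- its fixed field `N`, Galois of degree `n / p` over `M`, `[E : N] = p`
    let S : IntermediateField M E := IntermediateField.fixedField C
    haveI : IsGalois M S := IsGalois.of_fixedField_normal_subgroup C
    let N : Subfield Ω := liftSubfield S
    have hMN : M ≤ N := le_liftSubfield S
    have hNE : N ≤ E := liftSubfield_le S
    have hNEdeg : relFinrank N E hNE = p := by
      rw [relFinrank_liftSubfield_eq, IntermediateField.finrank_fixedField_eq_card, hCcard]
    have hfinNE : RelFinite N E hNE := relFinite_liftSubfield S
    have hfinMN : RelFinite M N hMN := relFinite_liftSubfield_bot S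
    have hgalMN := isGalois_liftSubfield_bot (M := M) (E := E) S
    have hMNdeg : relFinrank M N hMN = n / p := by
      have ht := (rel_tower (V := V) hMN hNE).2.2
      rw [hNEdeg] at ht
      have : relFinrank M E (hMN.trans hNE) = n := hn
      rw [this] at ht
      rw [ht, Nat.mul_div_cancel _ (by omega)]
    have hlt : n / p < n := Nat.div_lt_self (by omega) hp2
    have hdMN : IsDefectlessPair V M N hMN := ih (n / p) hlt M N hMN hM hfinMN hgalMN hMNdeg
    have hN : IsHenselizedRationalVT V K N := hM.of_relFinite hyp hMN hfinMN
    have hdNE : IsDefectlessPair V N E hNE :=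
      hN.isDefectlessPair_of_relFinrank_eq hyp hNE hfinNE hp2 hNEdeg
    exact ((isDefectlessPair_tower_iff hMN hNE hfin).mpr ⟨hdMN, hdNE⟩)
  · -- `P ≠ G`: its fixed field `N`, of degree `[G : P]` prime to `p` over `M`
    haveI : (P : Subgroup (E ≃ₐ[M] E)).FiniteIndex := Subgroup.finiteIndex_of_finite
    have hidx : ¬ p ∣ (P : Subgroup (E ≃ₐ[M] E)).index := P.not_dvd_index
    have hidx1 : (P : Subgroup (E ≃ₐ[M] E)).index ≠ 1 := fun h1 =>
      hPtop (Subgroup.index_eq_one.mp h1)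
    have hmul : Nat.card P * (P : Subgroup (E ≃ₐ[M] E)).index = n := by
      rw [Subgroup.card_mul_index, hcard]
    let S : IntermediateField M E := IntermediateField.fixedField (P : Subgroup (E ≃ₐ[M] E))
    let N : Subfield Ω := liftSubfield S
    have hMN : M ≤ N := le_liftSubfield S
    have hNE : N ≤ E := liftSubfield_le S
    have hNEdeg : relFinrank N E hNE = Nat.card P := by
      rw [relFinrank_liftSubfield_eq, IntermediateField.finrank_fixedField_eq_card]
    have hfinNE : RelFinite N E hNE := relFinite_liftSubfield S
    have hfinMN : RelFinite M N hMN := relFinite_liftSubfield_bot S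
    have hgalNE := isGalois_liftSubfield_top (M := M) (E := E) S
    have hPpos : 0 < Nat.card P := Nat.card_pos
    have hMNdeg : relFinrank M N hMN = (P : Subgroup (E ≃ₐ[M] E)).index := by
      have ht := (rel_tower (V := V) hMN hNE).2.2
      rw [hNEdeg] at ht
      have : relFinrank M E (hMN.trans hNE) = n := hn
      rw [this, ← hmul, mul_comm] at ht
      exact (Nat.eq_of_mul_eq_mul_right hPpos ht).symm
    have hdMN : IsDefectlessPair V M N hMN :=
      hM.isDefectlessPair_of_not_dvd hyp hMN hfinMN (Or.inr (hMNdeg ▸ hidx))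
    have hN : IsHenselizedRationalVT V K N := hM.of_relFinite hyp hMN hfinMN
    have hlt : Nat.card P < n := by
      have h0 : (P : Subgroup (E ≃ₐ[M] E)).index ≠ 0 := Subgroup.FiniteIndex.index_ne_zero
      have h2 : 2 ≤ (P : Subgroup (E ≃ₐ[M] E)).index := by omega
      calc Nat.card P < Nat.card P * 2 := by omega
        _ ≤ Nat.card P * (P : Subgroup (E ≃ₐ[M] E)).index := Nat.mul_le_mul_left _ h2
        _ = n := hmul
    have hdNE : IsDefectlessPair V N E hNE := ih (Nat.card P) hlt N E hNE hN hfinNE hgalNE hNEdeg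
    exact ((isDefectlessPair_tower_iff hMN hNE hfin).mpr ⟨hdMN, hdNE⟩)

end Induction

end Literature.AlgebraicGeometry.Resolution
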